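import Literature.NumberTheory.EllipticCurves.Curve388SelmerBoundsY
import HarnessLib

/-!
# Sharp descent via `2`-isogeny on `Y = [0, -58, 0, -2184, 0] : y² = x(x + 26)(x − 84)`: `rank Y(ℚ) = 2`, `Ш(Y/ℚ)[2] = 0`,
# `t_2(Y) = 0` (Silverman, AEC X.4.9 / X.4.7 with X.4.2(a))

Topic `NumberTheory/EllipticCurves`. First file of the RANK-`2` ISOGENY-DOOR cell of route ShaPrimaryTransfer (seat
bsd-line-spt-p1; companions `Curve388IsogenyRank`, `Curve388SelmerCertificatesA`/`B`, `Curve388SelmerPointClasses`, `Curve388NontrivialSha`): `Y` is a model of the curve with full rational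
`2`-torsion `X' = [0, 776, 0, 147840, 0]` (`Y = ⟨2, -336, 0, 0⟩ • X'`), whose quotient `X = [0, -388, 0, 676, 0]` by `⟨(0,0)⟩` has
`Ш(X/ℚ)[2] ≠ 0`. On `Y` the descent via the `2`-isogeny with kernel `(0,0)` is SHARP:

* `S(-58, -2184)` consists of all 16 squarefree divisor classes, each the `α`-image of a rational point (generators
  `α((-4), (-88)) = [-1]`, `α(150, 1320) = [6]`, `α(224, 2800) = [14]`, `α(T) = [-546]`, and products), so `#α(Y(ℚ)) ≥ 16`;
* `S'(-58, -2184) = S(116, 12100) ⊆ {1}`: every other class dies modulo a prime power (Silverman's congruence method,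
  tree lemma `Carrier6137.not_isSoluble_padic_twoIsogenyQuartic_of_zmodPow`);
* hence `rank Y(ℚ) = 2` (`2^{rank+2} = #α·#ᾱ ≥ 16·1`, `rank + 2 ≤ dim₂ S + dim₂ S' ≤ 4 + 0`), the descent is
  sharp, `Ш(Y/ℚ)[2] = 0` (tree `forall_mem_sha_two_smul_eq_zero_of_selmerRank_add_le`), `t_2(Y) = 0`.

Everything is re-verified by the kernel (obstruction moduli and points found by a plain search, 0 kit). Theorems only.

## References

* [SilvermanAEC2009] J. H. Silverman, *AEC*, 2nd ed.: Prop. X.4.9, Example X.4.10, Prop. X.4.7 with Thm. X.4.2(a).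
* [SilvermanTate2015] J. H. Silverman, J. Tate, *Rational Points on Elliptic Curves*, §3.5–§3.6.
-/

noncomputable section

open scoped Classical

namespace Literature.NumberTheory.EllipticCurves

namespace Curve388

open _root_.WeierstrassCurve _root_.WeierstrassCurve.Affine


/-! ## 1. Points, rank, sharpness -/

/-- The half-model literal for `(a,b) = (-58,-2184)` (private copy). [cite: SilvermanAEC2009, Prop. X.4.9] -/
private theorem lit_V₀Y :
    (⟨0, -((-58 : ℤ) : ℚ) / 2, 0, (((-58 : ℤ) : ℚ) ^ 2 - 4 * (-2184 : ℤ)) / 16, 0⟩ : WeierstrassCurve ℚ) =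
      ⟨0, 29, 0, (3025 / 4), 0⟩ := by
  ext <;> push_cast <;> ring

/-- The half-model of `Y'` is an elliptic curve (private copy). [cite: SilvermanAEC2009, Prop. X.4.9] -/
private theorem isElliptic_V₀Y : (⟨0, 29, 0, (3025 / 4), 0⟩ : WeierstrassCurve ℚ).IsElliptic := by
  rw [← lit_V₀Y]; exact isElliptic_halfModel habY

/-- `2^k ≤ 2^n` forces `k ≤ n`. [cite: SilvermanAEC2009, Prop. X.4.9] -/
private theorem le_of_two_pow_le {k n : ℕ} (h : 2 ^ k ≤ 2 ^ n) : k ≤ n :=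
  (Nat.pow_le_pow_iff_right (by norm_num)).mp h

/-- Squarefree integers with the same square class in `ℚ*/ℚ*²` are equal. [cite: SilvermanTate2015, §3.5] -/
private theorem eq_of_sqClass_intCast_eq {d₁ d₂ : ℤ} (h₁ : Squarefree d₁) (h₂ : Squarefree d₂)
    (he : sqClass (d₁ : ℚ) = sqClass (d₂ : ℚ)) : d₁ = d₂ := by
  have h0₁ : (d₁ : ℚ) ≠ 0 := by exact_mod_cast h₁.ne_zero
  have h0₂ : (d₂ : ℚ) ≠ 0 := by exact_mod_cast h₂.ne_zero
  have h1 : sqClass ((d₁ : ℚ) * d₂) = 1 := by rw [sqClass_mul h0₁ h0₂, he, SqUnits.mul_self]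
  obtain ⟨u, hu⟩ := (sqClass_eq_one_iff (mul_ne_zero h0₁ h0₂)).mp h1
  obtain ⟨m, hm⟩ : IsSquare (d₁ * d₂) := by
    rw [← Rat.isSquare_intCast_iff]
    exact ⟨u, by push_cast; rw [hu, pow_two]⟩
  exact eq_of_squarefree_of_mul_eq_sq h₁ h₂ (m := m) (by rw [hm, pow_two])

/-- Squarefreeness of a (small) integer from the factorisation of its absolute value. [cite: SilvermanTate2015, §3.5] -/
private theorem squarefree_int_of_natAbs {d : ℤ} {n : ℕ} (h : d.natAbs = n) (hn : n ≠ 0)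
    (hnd : n.primeFactorsList.Nodup) : Squarefree d :=
  Int.squarefree_natAbs.mp (h ▸ (Nat.squarefree_iff_nodup_primeFactorsList hn).mpr hnd)

/-- `[x t²] = [x]` in `ℚ*/ℚ*²`. [cite: SilvermanTate2015, §3.5] -/
private theorem sqClass_mul_sq' {x t : ℚ} (hx : x ≠ 0) (ht : t ≠ 0) :
    sqClass (x * t ^ 2) = sqClass x := by
  rw [sqClass_mul hx (pow_ne_zero 2 ht), sqClass_sq, mul_one]

/-- A rational solution of `y² = x³ + ax² + bx` is a nonsingular point of `E_{a,b}`. [cite: SilvermanTate2015, §3.5] -/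
private theorem nonsingular_of_eq' {a b x y : ℚ} [(⟨0, a, 0, b, 0⟩ : WeierstrassCurve ℚ).IsElliptic]
    (hy : y ^ 2 = x ^ 3 + a * x ^ 2 + b * x) : (⟨0, a, 0, b, 0⟩ : WeierstrassCurve ℚ).toAffine.Nonsingular x y := by
  refine Affine.equation_iff_nonsingular.mp ?_
  rw [Affine.equation_iff]
  show y ^ 2 + 0 * x * y + 0 * y = x ^ 3 + a * x ^ 2 + b * x + 0
  linear_combination hy

/-- A rational point `(x, y)`, `x ≠ 0`, of `E_{a,b}` puts `[x]` into `α(E_{a,b}(ℚ))`. [cite: SilvermanTate2015, §3.5] -/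
private theorem sqClass_mem_range_of_eq' {a b x y : ℚ} [(⟨0, a, 0, b, 0⟩ : WeierstrassCurve ℚ).IsElliptic]
    (hy : y ^ 2 = x ^ 3 + a * x ^ 2 + b * x) (hx : x ≠ 0) :
    sqClass x ∈ Set.range (⟨0, a, 0, b, 0⟩ : WeierstrassCurve ℚ).xSqClass :=
  ⟨.some x y (nonsingular_of_eq' hy), xSqClass_some_of_ne_zero _ hx⟩

/-- **`#α ≥ 16`** on `[0, -58, 0, -2184, 0]`: `[1]`, `α(T) = [-2184] = [-546]`, `α((-4), (-88)) = [-1]`, `α(150, 1320) = [6]`, `α(224, 2800) = [14]` and products. [cite: SilvermanTate2015, §3.5–§3.6] -/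
theorem card_range_xSqClass_Y_ge :
    (Set.range (⟨0, -58, 0, -2184, 0⟩ : WeierstrassCurve ℚ).xSqClass).Finite ∧
      16 ≤ Nat.card (Set.range (⟨0, -58, 0, -2184, 0⟩ : WeierstrassCurve ℚ).xSqClass) := by
  haveI := isElliptic_Y
  set W := (⟨0, -58, 0, -2184, 0⟩ : WeierstrassCurve ℚ) with hW
  have hfin : (Set.range W.xSqClass).Finite := by
    have h := (natCard_range_xSqClass_le (a := -58) (b := -2184) habY).1
    have e : (⟨0, ((-58 : ℤ) : ℚ), 0, ((-2184 : ℤ) : ℚ), 0⟩ : WeierstrassCurve ℚ) = W := by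
      rw [hW]; ext <;> push_cast <;> ring
    rw [e] at h
    exact h
  refine ⟨hfin, ?_⟩
  have hs1 : sqClass (((1 : ℤ)) : ℚ) ∈ Set.range W.xSqClass := by
    refine ⟨0, ?_⟩
    rw [xSqClass_zero, Int.cast_one]
    exact ((sqClass_eq_one_iff one_ne_zero).mpr ⟨1, by norm_num⟩).symm
  have hsm1 : sqClass (((-1 : ℤ)) : ℚ) ∈ Set.range W.xSqClass := by
    have h := sqClass_mem_range_of_eq' (a := -58) (b := -2184) (x := (-4)) (y := (-88))
      (by norm_num) (by norm_num)
    rwa [show ((-4) : ℚ) = -1 * (2) ^ 2 by norm_num, sqClass_mul_sq' (by norm_num) (by norm_num),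
      show (-1 : ℚ) = ((-1 : ℤ) : ℚ) by norm_num] at h
  have hs6 : sqClass (((6 : ℤ)) : ℚ) ∈ Set.range W.xSqClass := by
    have h := sqClass_mem_range_of_eq' (a := -58) (b := -2184) (x := 150) (y := 1320)
      (by norm_num) (by norm_num)
    rwa [show (150 : ℚ) = 6 * (5) ^ 2 by norm_num, sqClass_mul_sq' (by norm_num) (by norm_num),
      show (6 : ℚ) = ((6 : ℤ) : ℚ) by norm_num] at h
  have hsm6 : sqClass (((-6 : ℤ)) : ℚ) ∈ Set.range W.xSqClass := by
    have h := mul_mem_range_xSqClass W hsm1 hs6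
    rwa [← sqClass_mul (by norm_num) (by norm_num), ← Int.cast_mul,
      show ((-1 : ℤ) * 6 : ℤ) = -6 by norm_num] at h
  have hs14 : sqClass (((14 : ℤ)) : ℚ) ∈ Set.range W.xSqClass := by
    have h := sqClass_mem_range_of_eq' (a := -58) (b := -2184) (x := 224) (y := 2800)
      (by norm_num) (by norm_num)
    rwa [show (224 : ℚ) = 14 * (4) ^ 2 by norm_num, sqClass_mul_sq' (by norm_num) (by norm_num),
      show (14 : ℚ) = ((14 : ℤ) : ℚ) by norm_num] at h
  have hsm14 : sqClass (((-14 : ℤ)) : ℚ) ∈ Set.range W.xSqClass := by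
    have h := mul_mem_range_xSqClass W hsm1 hs14
    rwa [← sqClass_mul (by norm_num) (by norm_num), ← Int.cast_mul,
      show ((-1 : ℤ) * 14 : ℤ) = -14 by norm_num] at h
  have hs21 : sqClass (((21 : ℤ)) : ℚ) ∈ Set.range W.xSqClass := by
    have h := mul_mem_range_xSqClass W hs6 hs14
    rwa [← sqClass_mul (by norm_num) (by norm_num), ← Int.cast_mul,
      show ((6 : ℤ) * 14 : ℤ) = 21 * 2 ^ 2 by norm_num, Int.cast_mul,
      show (((2 ^ 2 : ℤ)) : ℚ) = (2 : ℚ) ^ 2 by norm_num, sqClass_mul_sq' (by norm_num) (by norm_num)] at h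
  have hsm21 : sqClass (((-21 : ℤ)) : ℚ) ∈ Set.range W.xSqClass := by
    have h := mul_mem_range_xSqClass W hsm1 hs21
    rwa [← sqClass_mul (by norm_num) (by norm_num), ← Int.cast_mul,
      show ((-1 : ℤ) * 21 : ℤ) = -21 by norm_num] at h
  have hsm546 : sqClass (((-546 : ℤ)) : ℚ) ∈ Set.range W.xSqClass := by
    refine ⟨W.twoTorsionPoint, ?_⟩
    rw [xSqClass_twoTorsionPoint]
    show sqClass (-2184 : ℚ) = _
    rw [show (-2184 : ℚ) = -546 * 2 ^ 2 by norm_num, sqClass_mul_sq' (by norm_num) (by norm_num)]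
    push_cast
    rfl
  have hs546 : sqClass (((546 : ℤ)) : ℚ) ∈ Set.range W.xSqClass := by
    have h := mul_mem_range_xSqClass W hsm546 hsm1
    rwa [← sqClass_mul (by norm_num) (by norm_num), ← Int.cast_mul,
      show ((-546 : ℤ) * -1 : ℤ) = 546 by norm_num] at h
  have hs26 : sqClass (((26 : ℤ)) : ℚ) ∈ Set.range W.xSqClass := by
    have h := mul_mem_range_xSqClass W hs546 hs21
    rwa [← sqClass_mul (by norm_num) (by norm_num), ← Int.cast_mul,
      show ((546 : ℤ) * 21 : ℤ) = 26 * 21 ^ 2 by norm_num, Int.cast_mul,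
      show (((21 ^ 2 : ℤ)) : ℚ) = (21 : ℚ) ^ 2 by norm_num, sqClass_mul_sq' (by norm_num) (by norm_num)] at h
  have hsm26 : sqClass (((-26 : ℤ)) : ℚ) ∈ Set.range W.xSqClass := by
    have h := mul_mem_range_xSqClass W hsm546 hs21
    rwa [← sqClass_mul (by norm_num) (by norm_num), ← Int.cast_mul,
      show ((-546 : ℤ) * 21 : ℤ) = -26 * 21 ^ 2 by norm_num, Int.cast_mul,
      show (((21 ^ 2 : ℤ)) : ℚ) = (21 : ℚ) ^ 2 by norm_num, sqClass_mul_sq' (by norm_num) (by norm_num)] at h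
  have hs39 : sqClass (((39 : ℤ)) : ℚ) ∈ Set.range W.xSqClass := by
    have h := mul_mem_range_xSqClass W hsm546 hsm14
    rwa [← sqClass_mul (by norm_num) (by norm_num), ← Int.cast_mul,
      show ((-546 : ℤ) * -14 : ℤ) = 39 * 14 ^ 2 by norm_num, Int.cast_mul,
      show (((14 ^ 2 : ℤ)) : ℚ) = (14 : ℚ) ^ 2 by norm_num, sqClass_mul_sq' (by norm_num) (by norm_num)] at h
  have hsm39 : sqClass (((-39 : ℤ)) : ℚ) ∈ Set.range W.xSqClass := by
    have h := mul_mem_range_xSqClass W hsm546 hs14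
    rwa [← sqClass_mul (by norm_num) (by norm_num), ← Int.cast_mul,
      show ((-546 : ℤ) * 14 : ℤ) = -39 * 14 ^ 2 by norm_num, Int.cast_mul,
      show (((14 ^ 2 : ℤ)) : ℚ) = (14 : ℚ) ^ 2 by norm_num, sqClass_mul_sq' (by norm_num) (by norm_num)] at h
  have hs91 : sqClass (((91 : ℤ)) : ℚ) ∈ Set.range W.xSqClass := by
    have h := mul_mem_range_xSqClass W hsm546 hsm6
    rwa [← sqClass_mul (by norm_num) (by norm_num), ← Int.cast_mul,
      show ((-546 : ℤ) * -6 : ℤ) = 91 * 6 ^ 2 by norm_num, Int.cast_mul,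
      show (((6 ^ 2 : ℤ)) : ℚ) = (6 : ℚ) ^ 2 by norm_num, sqClass_mul_sq' (by norm_num) (by norm_num)] at h
  have hsm91 : sqClass (((-91 : ℤ)) : ℚ) ∈ Set.range W.xSqClass := by
    have h := mul_mem_range_xSqClass W hsm546 hs6
    rwa [← sqClass_mul (by norm_num) (by norm_num), ← Int.cast_mul,
      show ((-546 : ℤ) * 6 : ℤ) = -91 * 6 ^ 2 by norm_num, Int.cast_mul,
      show (((6 ^ 2 : ℤ)) : ℚ) = (6 : ℚ) ^ 2 by norm_num, sqClass_mul_sq' (by norm_num) (by norm_num)] at h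
  have hsqf : ∀ d ∈ ({1, -1, 6, -6, 14, -14, 21, -21, 26, -26, 39, -39, 91, -91, 546, -546} : Finset ℤ), Squarefree d := by
    intro d hd
    simp only [Finset.mem_insert, Finset.mem_singleton] at hd
    rcases hd with rfl | rfl | rfl | rfl | rfl | rfl | rfl | rfl | rfl | rfl | rfl | rfl | rfl | rfl | rfl | rfl
    · exact squarefree_int_of_natAbs (n := 1) rfl one_ne_zero (by simp)
    · exact squarefree_int_of_natAbs (n := 1) rfl one_ne_zero (by simp)
    · exact squarefree_int_of_natAbs (n := 6) rfl (by norm_num) (by simp)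
    · exact squarefree_int_of_natAbs (n := 6) rfl (by norm_num) (by simp)
    · exact squarefree_int_of_natAbs (n := 14) rfl (by norm_num) (by simp)
    · exact squarefree_int_of_natAbs (n := 14) rfl (by norm_num) (by simp)
    · exact squarefree_int_of_natAbs (n := 21) rfl (by norm_num) (by simp)
    · exact squarefree_int_of_natAbs (n := 21) rfl (by norm_num) (by simp)
    · exact squarefree_int_of_natAbs (n := 26) rfl (by norm_num) (by simp)
    · exact squarefree_int_of_natAbs (n := 26) rfl (by norm_num) (by simp)
    · exact squarefree_int_of_natAbs (n := 39) rfl (by norm_num) (by simp)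
    · exact squarefree_int_of_natAbs (n := 39) rfl (by norm_num) (by simp)
    · exact squarefree_int_of_natAbs (n := 91) rfl (by norm_num) (by simp)
    · exact squarefree_int_of_natAbs (n := 91) rfl (by norm_num) (by simp)
    · exact squarefree_int_of_natAbs (n := 546) rfl (by norm_num) (by simp)
    · exact squarefree_int_of_natAbs (n := 546) rfl (by norm_num) (by simp)
  have hsub : (↑(({1, -1, 6, -6, 14, -14, 21, -21, 26, -26, 39, -39, 91, -91, 546, -546} : Finset ℤ).image fun d : ℤ => sqClass (d : ℚ)) :
      Set (SqUnits ℚ)) ⊆ Set.range W.xSqClass := by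
    intro c hc
    obtain ⟨d, hd, rfl⟩ := Finset.mem_image.mp (Finset.mem_coe.mp hc)
    simp only [Finset.mem_insert, Finset.mem_singleton] at hd
    rcases hd with rfl | rfl | rfl | rfl | rfl | rfl | rfl | rfl | rfl | rfl | rfl | rfl | rfl | rfl | rfl | rfl
    · exact hs1
    · exact hsm1
    · exact hs6
    · exact hsm6
    · exact hs14
    · exact hsm14
    · exact hs21
    · exact hsm21
    · exact hs26
    · exact hsm26
    · exact hs39
    · exact hsm39
    · exact hs91
    · exact hsm91
    · exact hs546
    · exact hsm546
  have hcard : (({1, -1, 6, -6, 14, -14, 21, -21, 26, -26, 39, -39, 91, -91, 546, -546} : Finset ℤ).image fun d : ℤ => sqClass (d : ℚ)).card = 16 := by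
    rw [Finset.card_image_of_injOn (fun d₁ h₁ d₂ h₂ he =>
      eq_of_sqClass_intCast_eq (hsqf d₁ h₁) (hsqf d₂ h₂) he)]
    rfl
  calc 16 = (↑(({1, -1, 6, -6, 14, -14, 21, -21, 26, -26, 39, -39, 91, -91, 546, -546} : Finset ℤ).image fun d : ℤ => sqClass (d : ℚ)) :
        Set (SqUnits ℚ)).ncard := by rw [Set.ncard_coe_finset, hcard]
    _ ≤ (Set.range W.xSqClass).ncard := Set.ncard_le_ncard hsub hfin
    _ = Nat.card (Set.range W.xSqClass) := (Nat.card_coe_set_eq _).symm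

/-- `b(a² − 4b) ≠ 0` for `Y' = E_{116,12100}`. [cite: SilvermanAEC2009, Prop. X.4.9] -/
private theorem habY' : (12100 : ℤ) * ((116 : ℤ) ^ 2 - 4 * 12100) ≠ 0 := by norm_num

/-- **`#α ≥ 1`** on `[0, 116, 0, 12100, 0]` (the class of `O`; the image is finite). [cite: SilvermanTate2015, §3.5–§3.6] -/
theorem card_range_xSqClass_Y'_ge :
    (Set.range (⟨0, 116, 0, 12100, 0⟩ : WeierstrassCurve ℚ).xSqClass).Finite ∧
      1 ≤ Nat.card (Set.range (⟨0, 116, 0, 12100, 0⟩ : WeierstrassCurve ℚ).xSqClass) := by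
  have hfin : (Set.range (⟨0, 116, 0, 12100, 0⟩ : WeierstrassCurve ℚ).xSqClass).Finite := by
    have h := (natCard_range_xSqClass_le (a := 116) (b := 12100) habY').1
    have e : (⟨0, ((116 : ℤ) : ℚ), 0, ((12100 : ℤ) : ℚ), 0⟩ : WeierstrassCurve ℚ) = ⟨0, 116, 0, 12100, 0⟩ := by
      ext <;> push_cast <;> ring
    rw [e] at h
    exact h
  haveI := hfin.to_subtype
  exact ⟨hfin, Nat.card_pos⟩

/-- **`rank Y(ℚ) = 2`** for `Y : y² = x(x + 26)(x − 84)`: `2^{rank+2} = #α·#ᾱ ≥ 16·1` and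
`rank + 2 ≤ dim₂ S + dim₂ S' ≤ 4 + 0`. [cite: SilvermanTate2015, §3.6] [cite: SilvermanAEC2009, Prop. X.4.7 with Thm. X.4.2(a)] -/
theorem mordellWeilRank_Y : (⟨0, -58, 0, -2184, 0⟩ : WeierstrassCurve ℚ).mordellWeilRank = 2 := by
  haveI := isElliptic_Y
  haveI := isElliptic_Y'
  have hup : (⟨0, -58, 0, -2184, 0⟩ : WeierstrassCurve ℚ).mordellWeilRank ≤ 2 := by
    have h := twoIsogeny_mordellWeilRank_add_two_le_holds (-58) (-2184) habY
    rw [lit_Y] at h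
    have h2 := twoIsogenySelmerRank_Y_add_le
    omega
  have hlow : 2 ≤ (⟨0, -58, 0, -2184, 0⟩ : WeierstrassCurve ℚ).mordellWeilRank := by
    have hmul := (⟨0, -58, 0, -2184, 0⟩ : WeierstrassCurve ℚ).natCard_range_xSqClass_mul
    have hcod : (⟨0, -58, 0, -2184, 0⟩ : WeierstrassCurve ℚ).twoIsogenyCodomain = ⟨0, 116, 0, 12100, 0⟩ := by
      rw [← lit_Y, twoIsogenyCodomain_mk_intCast, lit_Y']
    rw [hcod] at hmul
    have h1 := card_range_xSqClass_Y_ge.2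
    have h2 := card_range_xSqClass_Y'_ge.2
    have hpow : 2 ^ 4 ≤ 2 ^ ((⟨0, -58, 0, -2184, 0⟩ : WeierstrassCurve ℚ).mordellWeilRank + 2) := by
      rw [← hmul]
      calc 2 ^ 4 = 16 * 1 := by norm_num
        _ ≤ _ := Nat.mul_le_mul h1 h2
    have := le_of_two_pow_le hpow
    omega
  exact le_antisymm hup hlow

/-- **The descent on `Y` is sharp**: `dim₂ S + dim₂ S' ≤ rank + 2`. [cite: SilvermanAEC2009, Prop. X.4.7 with Thm. X.4.2(a)] -/
theorem twoIsogenySelmerRank_Y_add_le_rank :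
    twoIsogenySelmerRank (-58) (-2184) + twoIsogenySelmerRank' (-58) (-2184) ≤
      (⟨0, ((-58 : ℤ) : ℚ), 0, ((-2184 : ℤ) : ℚ), 0⟩ : WeierstrassCurve ℚ).mordellWeilRank + 2 := by
  rw [lit_Y, mordellWeilRank_Y]
  have h := twoIsogenySelmerRank_Y_add_le
  omega

/-- **`Ш(Y/ℚ)[2] = 0`** for `Y : y² = x(x + 26)(x − 84)`. [cite: SilvermanAEC2009, Prop. X.4.7 with Thm. X.4.2(a)] -/
theorem forall_mem_sha_Y_two_smul_eq_zero :
    ∀ c ∈ (⟨0, -58, 0, -2184, 0⟩ : WeierstrassCurve ℚ).sha, 2 • c = 0 → c = 0 := by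
  haveI : (⟨0, -((-58 : ℤ) : ℚ) / 2, 0, (((-58 : ℤ) : ℚ) ^ 2 - 4 * (-2184 : ℤ)) / 16, 0⟩ :
      WeierstrassCurve ℚ).IsElliptic := by rw [lit_V₀Y]; exact isElliptic_V₀Y
  haveI : (⟨0, ((-58 : ℤ) : ℚ), 0, ((-2184 : ℤ) : ℚ), 0⟩ : WeierstrassCurve ℚ).IsElliptic := by
    rw [lit_Y]; exact isElliptic_Y
  have h := forall_mem_sha_two_smul_eq_zero_of_selmerRank_add_le (a := -58) (b := -2184) habY
    twoIsogenySelmerRank_Y_add_le_rank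
  rwa [lit_Y] at h

/-- **`t_2(Y) = corank_{ℤ₂} Ш(Y/ℚ)[2^∞] = 0`.** [cite: SilvermanAEC2009, Prop. X.4.7 with Thm. X.4.2(a)] -/
theorem shaCorank_Y_two : (⟨0, -58, 0, -2184, 0⟩ : WeierstrassCurve ℚ).shaCorank 2 = 0 := by
  haveI := isElliptic_Y
  haveI : Fact (Nat.Prime 2) := ⟨Nat.prime_two⟩
  exact shaCorank_eq_zero_of_forall _ 2 forall_mem_sha_Y_two_smul_eq_zero


end Curve388

end Literature.NumberTheory.EllipticCurves

end
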